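/-
VALUE = THEOREM (the unified reflection-class exclusion for EVERY prime `p ≥ 5`, no certificate
evaluation), NOT summit progress (cell b2b-lgcu-borel, gen 24); the crux item
stmt-MatrixMultiplication-14079 is untouched.
-/
import Mathlib
import Summits.MatrixMultiplication.MatrixMultiplication.Theorems.SubgroupIdentityDesigns.Negative.ReflectionClassSiegelClass
import Summits.MatrixMultiplication.MatrixMultiplication.Theorems.SubgroupIdentityDesigns.Negative.ReflectionClassAnisoOrbit

/-!
# The reflection class groups carry no level-1 identity design — all primes `p ≥ 5`

VALUE = THEOREM (generic in the prime `p ≥ 5`), NOT summit progress; the crux item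
stmt-MatrixMultiplication-14079 is untouched and remains open.

Layer F7b — the assembly of the all-`p` proof (ORACLE-g24 §G24-1/§G24-3) of what
`ReflectionClassCertificate` established prime by prime through `native_decide`:

* `iso_orbit_sum` — the orbit sum over the stabiliser of an ISOTROPIC `x ≠ 0`
  (`= {E_β}` by `ReflectionClassSiegelClass.stab_iso_iff`) is `ReflectionClassOrbitU.orbitU_sum`;
* `orbit_sums` — with `ReflectionClassAnisoOrbit.aniso_orbit_sum`: every stabiliser orbit sum of
  the unified weight vanishes;
* `no_design` (**cover form**) — for `p ≥ 5`, `−c` a non-square and `σ = [c is a square]`, no triple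
  `(H₁,H₂,H₃) ≤ GL₃(𝔽_p)` whose product set `H₁H₂H₃` contains `classGroup p σ ∖ {1}` carries a
  level-1 identity design (`PermutationCertificate.no_design_of_permCert_subgroup`);
* **member forms**, every `m ≥ 3`: if `−1` is a non-square (`p ≡ 3 (4)`) no member of a triple may
  contain all reflections in vectors of square norm; if `−1` is a square (`p ≡ 1 (4)`) none may
  contain all reflections in vectors of non-square norm.
HONEST SCOPE.  Exactly one reflection class per prime (the one with `χ(−1) = −ε(σ)`); the other
class, `p = 3`, and the groups `K` not generated by a reflection class are not addressed here.
-/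

set_option linter.dupNamespace false

open scoped BigOperators Matrix

namespace Summit.MatrixMultiplication.MatrixMultiplication.Theorems.SubgroupIdentityDesigns.Negative
namespace ReflectionClassAllPrimes

open Summit.MatrixMultiplication.MatrixMultiplication.Theorems.LieRankDesigns.Negative (GLm Mat)
open ReflectionClassCertificate (V wt act act_mul act_one det3 det3_eq classGroup wt_off dot_act)
open NonsquareReflections (refl extVec extVec_dotProduct emb_refl)
open SummandTransport (emb design_comap)
open PermutationCertificate (no_design_of_permCert_subgroup)
open ReflectionClassSphere (wt_base_ne_zero)
open ReflectionClassPlane (w₁ w₁_dot_x w₁_dot_self)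
open ReflectionClassOrbitU (siegel orbitU_sum)
open ReflectionClassSiegel (siegelGL siegelGL_mulVec det_siegelGL siegelGL_inj)
open ReflectionClassSiegelClass (stab_iso_iff)
open ReflectionClassIsoSign (iota_of_mem_classGroup mem_O3)
open ReflectionClassAnisoOrbit (aniso_orbit_sum)

variable {p : ℕ} [hp : Fact p.Prime]

/-! ## The isotropic axis -/

section Iso

variable {c : ZMod p} {X₀ x : V p}

/-- An anisotropic vector orthogonal to an isotropic `x ≠ 0`. -/
theorem exists_perp_aniso (hx0 : x ≠ 0) (hxx : x ⬝ᵥ x = 0) :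
    ∃ y : V p, y ⬝ᵥ x = 0 ∧ y ⬝ᵥ y ≠ 0 := by
  obtain ⟨i, hi⟩ := Function.ne_iff.mp hx0
  refine ⟨w₁ x (Pi.single i 1), w₁_dot_x x _, ?_⟩
  rw [w₁_dot_self, hxx, zero_mul, zero_sub, dotProduct_single, mul_one, neg_ne_zero]
  exact pow_ne_zero 2 hi

/-- Off the sphere `{Q = c}` every term of an orbit sum vanishes. -/
theorem wt_act_off {σ : Bool} (hp2 : p ≠ 2) {s : GLm p 3} (hs : s ∈ classGroup p σ) {ω : V p}
    (hω : ¬ ω ⬝ᵥ ω = c) : wt c X₀ (act s ω) = 0 := by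
  refine wt_off ?_
  obtain ⟨hO, h⟩ := iota_of_mem_classGroup hp2 _ hs
  have hd : det3 (s : Mat p 3) * det3 (s : Mat p 3) = 1 := by
    rw [det3_eq]; rcases h with ⟨h, -⟩ | ⟨h, -⟩ <;> rw [h] <;> norm_num
  rwa [dot_act (mem_O3.mp hO) hd]

/-- **Isotropic axis.**  `Σ_{s ∈ K, s x = x} wt c X₀ (act s ω) = 0` for `x ≠ 0`, `Q(x) = 0`
(`p ≥ 5`): the stabiliser is `{E_β}` and the sum is `orbitU_sum`. -/
theorem iso_orbit_sum [DecidablePred (· ∈ classGroup p (decide (IsSquare c)))] (hp5 : 5 ≤ p)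
    (hc : ¬ IsSquare (-c)) (hX : X₀ ⬝ᵥ X₀ = c) (hx0 : x ≠ 0) (hxx : x ⬝ᵥ x = 0) (ω : V p) :
    (∑ s ∈ Finset.univ.filter
        (fun s : GLm p 3 => s ∈ classGroup p (decide (IsSquare c)) ∧ (s : Mat p 3) *ᵥ x = x),
      wt c X₀ (act s ω)) = 0 := by
  have hp2 : p ≠ 2 := by omega
  by_cases hω : ω ⬝ᵥ ω = c
  swap
  · exact Finset.sum_eq_zero fun s hs => wt_act_off hp2 (Finset.mem_filter.mp hs).2.1 hω
  obtain ⟨y, hyx, hy⟩ := exists_perp_aniso hx0 hxx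
  have hS : Finset.univ.filter
      (fun s : GLm p 3 => s ∈ classGroup p (decide (IsSquare c)) ∧ (s : Mat p 3) *ᵥ x = x) =
      Finset.univ.image (siegelGL x y) := by
    ext s
    rw [Finset.mem_filter, Finset.mem_image, stab_iso_iff hp5 hc hx0 hxx hyx hy s]
    simp only [Finset.mem_univ, true_and]
    constructor
    · rintro ⟨β, rfl⟩; exact ⟨β, rfl⟩
    · rintro ⟨β, rfl⟩; exact ⟨β, rfl⟩
  rw [hS, Finset.sum_image fun α _ β _ h => siegelGL_inj hp2 hx0 hxx hyx hy h]
  have key : ∀ β : ZMod p, wt c X₀ (act (siegelGL x y β) ω) = wt c X₀ (siegel x (β • y) ω) := by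
    intro β
    rw [act, det3_eq, det_siegelGL hxx hyx hy, one_smul, siegelGL_mulVec hp2 hxx hyx hy]
  simp_rw [key]
  exact orbitU_sum hp2 hc hX hω hx0 hxx hyx hy

/-- **All stabiliser orbit sums vanish** (`p ≥ 5`, `−c` a non-square, `X₀·X₀ = c`). -/
theorem orbit_sums [DecidablePred (· ∈ classGroup p (decide (IsSquare c)))] (hp5 : 5 ≤ p)
    (hc : ¬ IsSquare (-c)) (hX : X₀ ⬝ᵥ X₀ = c) :
    ∀ x : V p, x ≠ 0 → ∀ ω : V p,
      (∑ s ∈ Finset.univ.filter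
          (fun s : GLm p 3 => s ∈ classGroup p (decide (IsSquare c)) ∧ (s : Mat p 3) *ᵥ x = x),
        wt c X₀ (act s ω)) = 0 := by
  intro x hx0 ω
  by_cases hxx : x ⬝ᵥ x = 0
  · exact iso_orbit_sum hp5 hc hX hx0 hxx ω
  · exact aniso_orbit_sum (by omega) hc hX hxx ω

end Iso

/-! ## The exclusions, all primes `p ≥ 5` -/

section Exclusions

variable {m : ℕ} {σ : Bool} {c : ZMod p}

/-- **COVER FORM (all `p ≥ 5`).**  If `−c` is a non-square and `σ = [c is a square]`, no triple of
`GL₃(𝔽_p)` whose product set covers `classGroup p σ ∖ {1}` carries a level-1 identity design. -/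
theorem no_design (hp5 : 5 ≤ p) (hc : ¬ IsSquare (-c)) (hσ : decide (IsSquare c) = σ)
    {H₁ H₂ H₃ : Subgroup (GLm p 3)}
    (hmem : ∀ k ∈ classGroup p σ, k ≠ 1 → ∃ a ∈ H₁, ∃ b ∈ H₂, ∃ g ∈ H₃, a * b * g = k) :
    ¬ ∃ f : Mat p 3 → ℂ, (∀ M, 1 < M.rank → f M = 0) ∧
      (∑ M, f M * ZMod.stdAddChar (Matrix.trace (M * ((1 : GLm p 3) : Mat p 3)))) = 1 ∧
      ∀ a ∈ H₁, ∀ b ∈ H₂, ∀ g ∈ H₃, a * b * g ≠ 1 →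
        (∑ M, f M * ZMod.stdAddChar (Matrix.trace (M * ((a * b * g : GLm p 3) : Mat p 3)))) = 0 :=
  by
  classical
  subst hσ
  obtain ⟨a, b, hab⟩ := ZMod.sq_add_sq p c
  have hX : (![a, b, 0] : V p) ⬝ᵥ ![a, b, 0] = c := by
    rw [← hab]; simp [dotProduct, Fin.sum_univ_three]; ring
  exact no_design_of_permCert_subgroup (classGroup p (decide (IsSquare c))) act act_mul act_one
    (wt c ![a, b, 0]) ⟨_, wt_base_ne_zero hp5 hc hX⟩ (orbit_sums hp5 hc hX) hmem

/-- The class group lies in the preimage of a subgroup containing the class-`σ` reflections of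
`𝔽_p^{3+l}`. -/
theorem classGroup_le_comap {l : ℕ} {H : Subgroup (GLm p (3 + l))}
    (h : ∀ b : Fin (3 + l) → ZMod p, b ⬝ᵥ b ≠ 0 → decide (IsSquare (b ⬝ᵥ b)) = σ → refl b ∈ H) :
    classGroup p σ ≤ H.comap (emb finSumFinEquiv) := by
  refine (Subgroup.closure_le _).mpr ?_
  rintro _ ⟨b, hb0, hb, rfl⟩
  refine Subgroup.mem_comap.mpr ?_
  rw [emb_refl]
  exact h _ (by rwa [extVec_dotProduct]) (by rwa [extVec_dotProduct])

/-- Cover form pulled back along the block embedding `GL₃ → GL_{3+l}`. -/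
theorem no_design_emb (hp5 : 5 ≤ p) (hc : ¬ IsSquare (-c)) (hσ : decide (IsSquare c) = σ) {l : ℕ}
    {H₁ H₂ H₃ : Subgroup (GLm p (3 + l))}
    (hmem : ∀ k ∈ classGroup p σ, k ≠ 1 → ∃ a ∈ H₁.comap (emb finSumFinEquiv),
      ∃ b ∈ H₂.comap (emb finSumFinEquiv), ∃ g ∈ H₃.comap (emb finSumFinEquiv), a * b * g = k) :
    ¬ ∃ f : Mat p (3 + l) → ℂ, (∀ M, 1 < M.rank → f M = 0) ∧
      (∑ M, f M * ZMod.stdAddChar (Matrix.trace (M * ((1 : GLm p (3 + l)) : Mat p (3 + l))))) = 1 ∧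
      ∀ a ∈ H₁, ∀ b ∈ H₂, ∀ g ∈ H₃, a * b * g ≠ 1 →
        (∑ M, f M * ZMod.stdAddChar
          (Matrix.trace (M * ((a * b * g : GLm p (3 + l)) : Mat p (3 + l))))) = 0 :=
  fun hdes => no_design hp5 hc hσ hmem (design_comap finSumFinEquiv 1 hdes)

/-- `c = 1`: `−1` a non-square selects the square class. -/
theorem sq_class (h1 : ¬ IsSquare (-1 : ZMod p)) :
    ¬ IsSquare (-(1 : ZMod p)) ∧ decide (IsSquare (1 : ZMod p)) = true :=
  ⟨h1, decide_eq_true ⟨1, (mul_one 1).symm⟩⟩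

/-- `−1` a square: a non-square `c` has `−c` a non-square and selects the non-square class. -/
theorem nsq_class (hp2 : p ≠ 2) (h1 : IsSquare (-1 : ZMod p)) :
    ∃ c : ZMod p, ¬ IsSquare (-c) ∧ decide (IsSquare c) = false := by
  obtain ⟨c, hc⟩ := FiniteField.exists_nonsquare (F := ZMod p) (by rwa [ZMod.ringChar_zmod_n])
  refine ⟨c, fun h => hc ?_, decide_eq_false hc⟩
  obtain ⟨r, hr⟩ := h1
  obtain ⟨s, hs⟩ := h
  exact ⟨r * s, by linear_combination (s * s) * hr - hs⟩

/-- **SQUARE CLASS, `p ≥ 5`, `−1` a non-square (`p ≡ 3 (mod 4)`): NO MEMBER OF A TRIPLE IN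
`GL_m(𝔽_p)`, `m ≥ 3`, CONTAINS ALL REFLECTIONS IN VECTORS OF NON-ZERO SQUARE NORM** — member `1`. -/
theorem no_design_sq_mem₁ (hp5 : 5 ≤ p) (h1 : ¬ IsSquare (-1 : ZMod p)) (hm : 3 ≤ m)
    {H₁ H₂ H₃ : Subgroup (GLm p m)}
    (h₁ : ∀ b : Fin m → ZMod p, b ⬝ᵥ b ≠ 0 → IsSquare (b ⬝ᵥ b) → refl b ∈ H₁) :
    ¬ ∃ f : Mat p m → ℂ, (∀ M, 1 < M.rank → f M = 0) ∧
      (∑ M, f M * ZMod.stdAddChar (Matrix.trace (M * ((1 : GLm p m) : Mat p m)))) = 1 ∧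
      ∀ a ∈ H₁, ∀ b ∈ H₂, ∀ g ∈ H₃, a * b * g ≠ 1 →
        (∑ M, f M * ZMod.stdAddChar (Matrix.trace (M * ((a * b * g : GLm p m) : Mat p m)))) = 0 :=
  by
  obtain ⟨l, rfl⟩ := Nat.exists_eq_add_of_le hm
  exact no_design_emb hp5 (sq_class h1).1 (sq_class h1).2 (triple_of_le₁ (classGroup_le_comap
    fun b hb0 hb => h₁ b hb0 (of_decide_eq_true hb)))

/-- Square class, member `2`. -/
theorem no_design_sq_mem₂ (hp5 : 5 ≤ p) (h1 : ¬ IsSquare (-1 : ZMod p)) (hm : 3 ≤ m)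
    {H₁ H₂ H₃ : Subgroup (GLm p m)}
    (h₂ : ∀ b : Fin m → ZMod p, b ⬝ᵥ b ≠ 0 → IsSquare (b ⬝ᵥ b) → refl b ∈ H₂) :
    ¬ ∃ f : Mat p m → ℂ, (∀ M, 1 < M.rank → f M = 0) ∧
      (∑ M, f M * ZMod.stdAddChar (Matrix.trace (M * ((1 : GLm p m) : Mat p m)))) = 1 ∧
      ∀ a ∈ H₁, ∀ b ∈ H₂, ∀ g ∈ H₃, a * b * g ≠ 1 →
        (∑ M, f M * ZMod.stdAddChar (Matrix.trace (M * ((a * b * g : GLm p m) : Mat p m)))) = 0 :=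
  by
  obtain ⟨l, rfl⟩ := Nat.exists_eq_add_of_le hm
  exact no_design_emb hp5 (sq_class h1).1 (sq_class h1).2 (triple_of_le₂ (classGroup_le_comap
    fun b hb0 hb => h₂ b hb0 (of_decide_eq_true hb)))

/-- Square class, member `3`. -/
theorem no_design_sq_mem₃ (hp5 : 5 ≤ p) (h1 : ¬ IsSquare (-1 : ZMod p)) (hm : 3 ≤ m)
    {H₁ H₂ H₃ : Subgroup (GLm p m)}
    (h₃ : ∀ b : Fin m → ZMod p, b ⬝ᵥ b ≠ 0 → IsSquare (b ⬝ᵥ b) → refl b ∈ H₃) :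
    ¬ ∃ f : Mat p m → ℂ, (∀ M, 1 < M.rank → f M = 0) ∧
      (∑ M, f M * ZMod.stdAddChar (Matrix.trace (M * ((1 : GLm p m) : Mat p m)))) = 1 ∧
      ∀ a ∈ H₁, ∀ b ∈ H₂, ∀ g ∈ H₃, a * b * g ≠ 1 →
        (∑ M, f M * ZMod.stdAddChar (Matrix.trace (M * ((a * b * g : GLm p m) : Mat p m)))) = 0 :=
  by
  obtain ⟨l, rfl⟩ := Nat.exists_eq_add_of_le hm
  exact no_design_emb hp5 (sq_class h1).1 (sq_class h1).2 (triple_of_le₃ (classGroup_le_comap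
    fun b hb0 hb => h₃ b hb0 (of_decide_eq_true hb)))

/-- **NON-SQUARE CLASS, `p ≥ 5`, `−1` a square (`p ≡ 1 (mod 4)`): no member of a triple in
`GL_m(𝔽_p)`, `m ≥ 3`, contains all reflections in vectors of non-square norm** — member `1`. -/
theorem no_design_nsq_mem₁ (hp5 : 5 ≤ p) (h1 : IsSquare (-1 : ZMod p)) (hm : 3 ≤ m)
    {H₁ H₂ H₃ : Subgroup (GLm p m)}
    (h₁ : ∀ b : Fin m → ZMod p, ¬ IsSquare (b ⬝ᵥ b) → refl b ∈ H₁) :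
    ¬ ∃ f : Mat p m → ℂ, (∀ M, 1 < M.rank → f M = 0) ∧
      (∑ M, f M * ZMod.stdAddChar (Matrix.trace (M * ((1 : GLm p m) : Mat p m)))) = 1 ∧
      ∀ a ∈ H₁, ∀ b ∈ H₂, ∀ g ∈ H₃, a * b * g ≠ 1 →
        (∑ M, f M * ZMod.stdAddChar (Matrix.trace (M * ((a * b * g : GLm p m) : Mat p m)))) = 0 :=
  by
  obtain ⟨l, rfl⟩ := Nat.exists_eq_add_of_le hm
  obtain ⟨c, hc, hσ⟩ := nsq_class (by omega) h1
  exact no_design_emb hp5 hc hσ (triple_of_le₁ (classGroup_le_comap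
    fun b _ hb => h₁ b (of_decide_eq_false hb)))

/-- Non-square class, member `2`. -/
theorem no_design_nsq_mem₂ (hp5 : 5 ≤ p) (h1 : IsSquare (-1 : ZMod p)) (hm : 3 ≤ m)
    {H₁ H₂ H₃ : Subgroup (GLm p m)}
    (h₂ : ∀ b : Fin m → ZMod p, ¬ IsSquare (b ⬝ᵥ b) → refl b ∈ H₂) :
    ¬ ∃ f : Mat p m → ℂ, (∀ M, 1 < M.rank → f M = 0) ∧
      (∑ M, f M * ZMod.stdAddChar (Matrix.trace (M * ((1 : GLm p m) : Mat p m)))) = 1 ∧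
      ∀ a ∈ H₁, ∀ b ∈ H₂, ∀ g ∈ H₃, a * b * g ≠ 1 →
        (∑ M, f M * ZMod.stdAddChar (Matrix.trace (M * ((a * b * g : GLm p m) : Mat p m)))) = 0 :=
  by
  obtain ⟨l, rfl⟩ := Nat.exists_eq_add_of_le hm
  obtain ⟨c, hc, hσ⟩ := nsq_class (by omega) h1
  exact no_design_emb hp5 hc hσ (triple_of_le₂ (classGroup_le_comap
    fun b _ hb => h₂ b (of_decide_eq_false hb)))

/-- Non-square class, member `3`. -/
theorem no_design_nsq_mem₃ (hp5 : 5 ≤ p) (h1 : IsSquare (-1 : ZMod p)) (hm : 3 ≤ m)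
    {H₁ H₂ H₃ : Subgroup (GLm p m)}
    (h₃ : ∀ b : Fin m → ZMod p, ¬ IsSquare (b ⬝ᵥ b) → refl b ∈ H₃) :
    ¬ ∃ f : Mat p m → ℂ, (∀ M, 1 < M.rank → f M = 0) ∧
      (∑ M, f M * ZMod.stdAddChar (Matrix.trace (M * ((1 : GLm p m) : Mat p m)))) = 1 ∧
      ∀ a ∈ H₁, ∀ b ∈ H₂, ∀ g ∈ H₃, a * b * g ≠ 1 →
        (∑ M, f M * ZMod.stdAddChar (Matrix.trace (M * ((a * b * g : GLm p m) : Mat p m)))) = 0 :=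
  by
  obtain ⟨l, rfl⟩ := Nat.exists_eq_add_of_le hm
  obtain ⟨c, hc, hσ⟩ := nsq_class (by omega) h1
  exact no_design_emb hp5 hc hσ (triple_of_le₃ (classGroup_le_comap
    fun b _ hb => h₃ b (of_decide_eq_false hb)))

end Exclusions

end ReflectionClassAllPrimes
end Summit.MatrixMultiplication.MatrixMultiplication.Theorems.SubgroupIdentityDesigns.Negative
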